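import Mathlib
import Summits.Ventures.HodgeRepro2.T5SemisimpleQuotient

/-!
# Finite length ⇒ the maximal semisimple quotient `θ(π) = Θ(π) ⧸ rad` is semisimple

Blind cell `pub-hodge-repro2`, seat p8 (gen 6), Tier-5 kernel support for the N3 record
(§N3.11.4 rows (r2)–(r3): Gan–Takeda's `θ(π)` = the maximal semisimple quotient of `Θ(π)`, with
`Θ(π)` of finite length «shown by Kudla [k83]» — PRINTED; CHECK-N3 §8 and Δ-N3.11-a).
`T5SemisimpleQuotient` (p391357) proved that a simple quotient of `Θ` factors through
`Θ ⧸ radical` (no length needed) and that a semisimple `θ` with scalar endomorphisms is `0` or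
irreducible; what it left to the prose was «Kudla's finite length identifies `θ(π)` with
`Θ(π) ⧸ rad`», i.e. that the quotient by the radical IS semisimple.  This file closes that:

* `radical_eq_jacobson` — the `radical` of p391357 is Mathlib's `Module.jacobson`;
* `isSemisimpleModule_quotient_radical` — **for an Artinian module, `M ⧸ radical` is
  semisimple** (Mathlib: `IsArtinian.isSemisimpleModule_iff_jacobson` +
  `Module.jacobson_quotient_jacobson`); `…_of_isFiniteLength` — the finite-length form
  (`isFiniteLength_iff_isNoetherian_isArtinian`);
* `exists_isCompl_linearEquiv_of_surjective` — every simple quotient `S` of a finite-length `M`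
  is (isomorphic to) a DIRECT SUMMAND of `θ = M ⧸ radical` — the row-(r2)/(r3) reading
  «π′ is an irreducible quotient of Θ(π) ⟺ π′ is a direct summand of θ(π)», forward direction;
* `exists_surjective_of_isCompl` — the converse: a direct summand of `θ` is a quotient of `M`.

What stays prose: that `Θ(π)` has finite length (Kudla, printed) and the Hecke dictionary.
Nothing arithmetic is asserted.

README §8(d): uses an L-value-free non-vanishing device: NO.
-/

namespace Summit.Ventures.HodgeRepro2.T5ThetaFiniteLength

open Summit.Ventures.HodgeRepro2.T5SemisimpleQuotient

section Radical

variable (R M : Type*) [Ring R] [AddCommGroup M] [Module R M]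

/-- The `radical` of `T5SemisimpleQuotient` (`⨅` of the coatoms) is Mathlib's `Module.jacobson`. -/
theorem radical_eq_jacobson : radical R M = Module.jacobson R M := by
  rw [Module.jacobson, sInf_eq_iInf]
  rfl

/-- **Artinian ⇒ `M ⧸ jacobson` is semisimple.** -/
theorem isSemisimpleModule_quotient_jacobson [IsArtinian R M] :
    IsSemisimpleModule R (M ⧸ Module.jacobson R M) :=
  (IsArtinian.isSemisimpleModule_iff_jacobson R _).mpr (Module.jacobson_quotient_jacobson R M)

/-- **Artinian ⇒ `θ = M ⧸ radical` is semisimple.** -/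
theorem isSemisimpleModule_quotient_radical [IsArtinian R M] :
    IsSemisimpleModule R (M ⧸ radical R M) := by
  rw [radical_eq_jacobson]
  exact isSemisimpleModule_quotient_jacobson R M

/-- **Finite length ⇒ `θ = M ⧸ radical` is semisimple** (Kudla's input, as printed: «`Θ(π)` has
finite length»). -/
theorem isSemisimpleModule_quotient_radical_of_isFiniteLength (h : IsFiniteLength R M) :
    IsSemisimpleModule R (M ⧸ radical R M) :=
  haveI : IsArtinian R M := (isFiniteLength_iff_isNoetherian_isArtinian.mp h).2
  isSemisimpleModule_quotient_radical R M

end Radical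

section Summand

variable {R M : Type*} [Ring R] [AddCommGroup M] [Module R M]
  {S : Type*} [AddCommGroup S] [Module R S]

/-- **A simple quotient of an Artinian module is a direct summand of `θ = M ⧸ radical`**: for
`f : M → S` onto a simple `S` there are `g : θ → S` with `g ∘ mkQ = f` and a complement `K` of
`ker g` in `θ` with `K ≅ S`. -/
theorem exists_isCompl_linearEquiv_of_surjective [IsArtinian R M] [IsSimpleModule R S]
    (f : M →ₗ[R] S) (hf : Function.Surjective f) :
    ∃ (g : M ⧸ radical R M →ₗ[R] S) (K : Submodule R (M ⧸ radical R M)),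
      g ∘ₗ (radical R M).mkQ = f ∧ IsCompl (LinearMap.ker g) K ∧ Nonempty (K ≃ₗ[R] S) := by
  obtain ⟨g, hg⟩ := exists_factor_radical f hf
  have hgs : Function.Surjective g := by
    intro s
    obtain ⟨m, hm⟩ := hf s
    exact ⟨(radical R M).mkQ m, by rw [← hm, ← hg]; rfl⟩
  haveI := isSemisimpleModule_quotient_radical R M
  obtain ⟨K, hK⟩ := exists_isCompl (LinearMap.ker g)
  refine ⟨g, K, hg, hK, ⟨?_⟩⟩
  exact (Submodule.quotientEquivOfIsCompl (LinearMap.ker g) K hK).symm.trans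
    (g.quotKerEquivOfSurjective hgs)

/-- The finite-length form. -/
theorem exists_isCompl_linearEquiv_of_surjective_of_isFiniteLength (h : IsFiniteLength R M)
    [IsSimpleModule R S] (f : M →ₗ[R] S) (hf : Function.Surjective f) :
    ∃ (g : M ⧸ radical R M →ₗ[R] S) (K : Submodule R (M ⧸ radical R M)),
      g ∘ₗ (radical R M).mkQ = f ∧ IsCompl (LinearMap.ker g) K ∧ Nonempty (K ≃ₗ[R] S) :=
  haveI : IsArtinian R M := (isFiniteLength_iff_isNoetherian_isArtinian.mp h).2
  exists_isCompl_linearEquiv_of_surjective f hf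

/-- **Conversely, a direct summand `K` of `θ = M ⧸ radical` is a quotient of `M`**: if `K'` is a
complement of `K`, then `M → θ → θ ⧸ K' ≅ K` is onto. -/
theorem exists_surjective_of_isCompl (K K' : Submodule R (M ⧸ radical R M)) (h : IsCompl K K') :
    ∃ f : M →ₗ[R] K, Function.Surjective f := by
  let e := Submodule.quotientEquivOfIsCompl K' K h.symm
  refine ⟨e.toLinearMap ∘ₗ K'.mkQ ∘ₗ (radical R M).mkQ, ?_⟩
  intro x
  obtain ⟨y, hy⟩ := K'.mkQ_surjective (e.symm x)
  obtain ⟨m, hm⟩ := (radical R M).mkQ_surjective y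
  refine ⟨m, ?_⟩
  rw [LinearMap.comp_apply, LinearMap.comp_apply, hm, hy]
  exact e.apply_symm_apply x

end Summand

end Summit.Ventures.HodgeRepro2.T5ThetaFiniteLength
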